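import Summits.CriticalPhenomena.PercolationContinuityZ3.Theorems.PercNearOneGluingNoHeavyLowerTailOneCutFiveZeroOneHalf
import Literature.Probability.LatticeModels.ProdBernoulliIndependence
import Literature.Probability.Percolation.PercolationEvents
import HarnessLib

/-!
# `NoHeavyLowerTail` (stmt-CriticalPhenomena-4575) — the |A| = 5 glued rung from ONE conditional two-point inequality (V3MAX),
# and the unconditional two-point lemma it extends

Support file (prover seat `prim-a5-assembly-2`, gen 3; `--supports stmt-CriticalPhenomena-4575 --as helper`; memo
`run/shared/lean/prim/prim-a5/ASSEMBLY.md` §13, INEQ-CLAIMS row A5-V3MAX, census `prim-a5/prim-a5-assembly-2/lab-gen3/`).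
One `@[conjecture]` definition, no named facts, no sorries.  HONEST LABEL: the crux 4575 is CLOSED (CSH route, p205010); the
|A| = 5 one-cut rung is independent mathematics / the insurance line; `CondTwoPoint` below is OPEN and nothing here asserts it.

`μ = prodBernoulli w` on `Fin n`, observer `o`, vertices `a, b, c`, `q_v = μ(o ↔ v)`, pocket `B = C_o ∩ {a,b,c}`,
`s_v = μ(B = {v})`, `d_uv = μ(B = {u,v})`.

* `OneCutFive.twoPoint_prod_le` — PROVED, the unconditional TWO-POINT LEMMA: `q_c ≥ q_b` and `q_c ≥ ½` give
  `μ(o↔b, o↮c)·μ(o↮b, o↮c) ≤ μ(o↔b, o↔c)·μ(o↮b, o↔c)`, i.e. `P(o↔c | o↔b) + P(o↔c | o↮b) ≥ 1`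
  (Harris `μ(B∩C) ≥ μ(B)μ(C)` and `μ(B∩C) ≤ μ(B)`; margin `= u(r−p) + (p−u)(p+r−1)`, and `≥ p(2r−1)(1−p)` when `p + r < 1`).
* `OneCutFive.CondTwoPoint` — the CONJECTURED a-conditioned form (row V3MAX): `q_c ≥ max(q_a, q_b, ½)` ⟹
  `s_a · s_b ≤ d_ac · d_bc`, i.e. `P(o↔c | o↔a, o↮b) + P(o↔c | o↔b, o↮a) ≥ 1` (census-clean: exhaustive rooted supports
  `n ≤ 6`, 0 / 90 597; adversarial climbs, minimum relative margin `+2.7e-4` on the boundary `q_c = ½`; violated by every known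
  pseudo-law of `Z(3,2)`, so it is outside the proved four-point cone).
* `OneCutFive.zmax_of_condTwoPoint` — V3MAX ⟹ Zmax: `q_a ≤ q_b`, `q_a ≤ q_c`, `max(q_b, q_c) ≥ ½` ⟹ `s_a ≤ d_bc`
  (from `s_a s_b ≤ d_ac d_bc` and the linear `s_a + d_ac ≤ s_b + d_bc`).
* `OneCutFive.pocketHalf_of_condTwoPoint`, `OneCutFive.zeroOneThree_of_condTwoPoint`, `OneCutFive.oneCut5_at_of_mem_of_condTwoPoint` —
  hence (POCKET-½), `Z(3,2)` (`ZeroOneThree`) and the `o ∈ A` half of `OneCut5`, by the tree's p204733 / p204552.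
-/

noncomputable section

namespace Summit.CriticalPhenomena.PercolationContinuityZ3.Theorems

open MeasureTheory Set Literature.Probability.LatticeModels Literature.Probability.Percolation
open scoped Classical BigOperators

namespace OneCutFive

variable {n : ℕ}

/-! ### Atom bookkeeping for two connection events -/

/-- `μ(X) = μ(X ∩ Y) + μ(X ∖ Y)` on the finite configuration space. [folklore] -/
private theorem real_eq_inter_add_diff (μ : Measure (BondConfig (Fin n))) [IsProbabilityMeasure μ]
    (X Y : Set (BondConfig (Fin n))) : μ.real X = μ.real (X ∩ Y) + μ.real (X \ Y) :=
  (measureReal_inter_add_sdiff (μ := μ) (s := X) MeasurableSet.of_discrete).symm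

/-- `μ(o↔x) − μ(o↔y) = μ(o↔x, o↮y) − μ(o↔y, o↮x)`. [folklore] -/
theorem real_openConn_sub (μ : Measure (BondConfig (Fin n))) [IsProbabilityMeasure μ] (o x y : Fin n) :
    μ.real (openConn o x) - μ.real (openConn o y) =
      μ.real {ω : BondConfig (Fin n) | ω ∈ openConn o x ∧ ω ∉ openConn o y} -
        μ.real {ω : BondConfig (Fin n) | ω ∈ openConn o y ∧ ω ∉ openConn o x} := by
  have hx := real_eq_inter_add_diff μ (openConn o x) (openConn o y)
  have hy := real_eq_inter_add_diff μ (openConn o y) (openConn o x)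
  have hxy : (openConn o x : Set (BondConfig (Fin n))) ∩ openConn o y = openConn o y ∩ openConn o x := Set.inter_comm _ _
  have h1 : (openConn o x : Set (BondConfig (Fin n))) \ openConn o y = {ω | ω ∈ openConn o x ∧ ω ∉ openConn o y} := rfl
  have h2 : (openConn o y : Set (BondConfig (Fin n))) \ openConn o x = {ω | ω ∈ openConn o y ∧ ω ∉ openConn o x} := rfl
  rw [← hxy] at hy
  rw [← h1, ← h2]; linarith

/-- Splitting `{o↔x, o↮y}` along `{o↔z}`. [folklore] -/
theorem real_conn_notConn_split (μ : Measure (BondConfig (Fin n))) [IsProbabilityMeasure μ] (o x y z : Fin n) :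
    μ.real {ω : BondConfig (Fin n) | ω ∈ openConn o x ∧ ω ∉ openConn o y} =
      μ.real {ω : BondConfig (Fin n) | ω ∈ openConn o x ∧ ω ∉ openConn o y ∧ ω ∉ openConn o z} +
        μ.real {ω : BondConfig (Fin n) | ω ∈ openConn o x ∧ ω ∉ openConn o y ∧ ω ∈ openConn o z} := by
  have hmeas : ∀ s : Set (BondConfig (Fin n)), MeasurableSet s := fun _ => MeasurableSet.of_discrete
  have hunion : {ω : BondConfig (Fin n) | ω ∈ openConn o x ∧ ω ∉ openConn o y} =
      {ω : BondConfig (Fin n) | ω ∈ openConn o x ∧ ω ∉ openConn o y ∧ ω ∉ openConn o z} ∪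
        {ω : BondConfig (Fin n) | ω ∈ openConn o x ∧ ω ∉ openConn o y ∧ ω ∈ openConn o z} := by
    ext ω; simp only [mem_setOf_eq, mem_union]; tauto
  have hdisj : Disjoint {ω : BondConfig (Fin n) | ω ∈ openConn o x ∧ ω ∉ openConn o y ∧ ω ∉ openConn o z}
      {ω : BondConfig (Fin n) | ω ∈ openConn o x ∧ ω ∉ openConn o y ∧ ω ∈ openConn o z} := by
    rw [Set.disjoint_left]; rintro ω ⟨_, _, hz⟩ ⟨_, _, hz'⟩; exact hz hz'
  rw [hunion, measureReal_union hdisj (hmeas _)]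

/-! ### The unconditional two-point lemma -/

/-- **Two-point lemma (PROVED).**  If `μ(o↔b) ≤ μ(o↔c)` and `μ(o↔c) ≥ ½` then
`μ(o↔b, o↮c)·μ(o↮b, o↮c) ≤ μ(o↔b, o↔c)·μ(o↮b, o↔c)`, i.e. `P(o↔c | o↔b) + P(o↔c | o↮b) ≥ 1`.
With `u = μ(b,c)`, `p = μ(b)`, `r = μ(c)`: RHS − LHS `= u(r−p) + (p−u)(p+r−1)`; for `p + r ≥ 1` both terms are `≥ 0`
(`u ≤ p ≤ r`), for `p + r < 1` Harris `u ≥ pr` gives `≥ p(2r−1)(1−p) ≥ 0`. [this work] -/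
theorem twoPoint_prod_le (w : Sym2 (Fin n) → unitInterval) (o b c : Fin n)
    (hbc : (prodBernoulli w).real (openConn o b) ≤ (prodBernoulli w).real (openConn o c))
    (hhalf : 1 / 2 ≤ (prodBernoulli w).real (openConn o c)) :
    (prodBernoulli w).real {ω : BondConfig (Fin n) | ω ∈ openConn o b ∧ ω ∉ openConn o c} *
        (prodBernoulli w).real {ω : BondConfig (Fin n) | ω ∉ openConn o b ∧ ω ∉ openConn o c} ≤
      (prodBernoulli w).real {ω : BondConfig (Fin n) | ω ∈ openConn o b ∧ ω ∈ openConn o c} *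
        (prodBernoulli w).real {ω : BondConfig (Fin n) | ω ∉ openConn o b ∧ ω ∈ openConn o c} := by
  set μ := prodBernoulli w with hμ
  have hmeas : ∀ s : Set (BondConfig (Fin n)), MeasurableSet s := fun _ => MeasurableSet.of_discrete
  set B : Set (BondConfig (Fin n)) := openConn o b with hB
  set C : Set (BondConfig (Fin n)) := openConn o c with hC
  -- the four atoms in terms of u = μ(B ∩ C), p = μ B, r = μ C
  have hpB : μ.real B = μ.real (B ∩ C) + μ.real (B \ C) := real_eq_inter_add_diff μ B C
  have hrC : μ.real C = μ.real (C ∩ B) + μ.real (C \ B) := real_eq_inter_add_diff μ C B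
  have hCB : C ∩ B = B ∩ C := Set.inter_comm _ _
  have hcomplB : μ.real B + μ.real Bᶜ = 1 := by rw [measureReal_add_measureReal_compl (hmeas B), probReal_univ]
  have hBc : μ.real Bᶜ = μ.real (Bᶜ ∩ C) + μ.real (Bᶜ \ C) := real_eq_inter_add_diff μ Bᶜ C
  have e1 : {ω : BondConfig (Fin n) | ω ∈ B ∧ ω ∉ C} = B \ C := rfl
  have e2 : {ω : BondConfig (Fin n) | ω ∉ B ∧ ω ∉ C} = Bᶜ \ C := by ext ω; simp
  have e3 : {ω : BondConfig (Fin n) | ω ∈ B ∧ ω ∈ C} = B ∩ C := rfl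
  have e4 : {ω : BondConfig (Fin n) | ω ∉ B ∧ ω ∈ C} = Bᶜ ∩ C := by ext ω; simp
  have e4' : C \ B = Bᶜ ∩ C := by ext ω; simp [and_comm]
  rw [e1, e2, e3, e4]
  rw [hCB, e4'] at hrC
  -- Harris: μ(B ∩ C) ≥ μ(B) μ(C)
  have hHarris : μ.real B * μ.real C ≤ μ.real (B ∩ C) :=
    prodBernoulli_harris w (isUpperSet_openConn o b) (isUpperSet_openConn o c) (hmeas _) (hmeas _)
  -- μ(B ∩ C) ≤ μ(B)
  have huB : μ.real (B ∩ C) ≤ μ.real B := measureReal_mono Set.inter_subset_left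
  have h0 : 0 ≤ μ.real (B \ C) := measureReal_nonneg
  have h0' : 0 ≤ μ.real (Bᶜ \ C) := measureReal_nonneg
  have h0'' : 0 ≤ μ.real (Bᶜ ∩ C) := measureReal_nonneg
  have h0''' : 0 ≤ μ.real (B ∩ C) := measureReal_nonneg
  have hB1 : μ.real B ≤ 1 := measureReal_le_one
  -- case split on p + r ≥ 1
  by_cases hpr : 1 ≤ μ.real B + μ.real C
  · nlinarith [hbc, hpr, huB]
  · push Not at hpr
    nlinarith [hHarris, hhalf, hpr, huB, hbc, mul_nonneg (sub_nonneg.2 hHarris) (by linarith : (0:ℝ) ≤ 1 - 2 * μ.real B + 0),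
      mul_nonneg (mul_nonneg (measureReal_nonneg (μ := μ) (s := B)) (by linarith : (0:ℝ) ≤ 2 * μ.real C - 1)) (sub_nonneg.2 hB1)]

/-! ### The conjectured conditional two-point inequality (row V3MAX) and its consequences -/

/-- **V3MAX, the conditional two-point inequality (CONJECTURE).**  For every finite weighted graph and distinct `o, a, b, c`
with `μ(o↔c) ≥ max(μ(o↔a), μ(o↔b), ½)`:  `μ(B={a})·μ(B={b}) ≤ μ(B={a,c})·μ(B={b,c})`, equivalently
`P(o↔c | o↔a, o↮b) + P(o↔c | o↔b, o↮a) ≥ 1` — adding the strongest vertex to the pocket in two copies carrying OPPOSITE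
information about `a, b` does not lose mass.  The `a`-free case is `twoPoint_prod_le`.  OPEN (census-clean on all rooted supports
with `n ≤ 6` and under adversarial search; outside the proved four-point cone). [this work] [status: open] -/
@[conjecture] def CondTwoPoint : Prop :=
  ∀ (n : ℕ) (w : Sym2 (Fin n) → unitInterval) (o a b c : Fin n),
    o ≠ a → o ≠ b → o ≠ c → a ≠ b → a ≠ c → b ≠ c →
    (prodBernoulli w).real (openConn o a) ≤ (prodBernoulli w).real (openConn o c) →
    (prodBernoulli w).real (openConn o b) ≤ (prodBernoulli w).real (openConn o c) →
    1 / 2 ≤ (prodBernoulli w).real (openConn o c) →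
    (prodBernoulli w).real {ω : BondConfig (Fin n) | ω ∈ openConn o a ∧ ω ∉ openConn o b ∧ ω ∉ openConn o c} *
        (prodBernoulli w).real {ω : BondConfig (Fin n) | ω ∉ openConn o a ∧ ω ∈ openConn o b ∧ ω ∉ openConn o c} ≤
      (prodBernoulli w).real {ω : BondConfig (Fin n) | ω ∈ openConn o a ∧ ω ∉ openConn o b ∧ ω ∈ openConn o c} *
        (prodBernoulli w).real {ω : BondConfig (Fin n) | ω ∉ openConn o a ∧ ω ∈ openConn o b ∧ ω ∈ openConn o c}

/-- The algebra of the exchange: from `s_a·s_b ≤ d_ac·d_bc`, `s_a + d_ac ≤ s_b + d_bc` and nonnegativity, `s_a ≤ d_bc`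
(`(s_a − d_bc)(s_b + d_bc) ≤ 0`, and `s_b + d_bc = 0` forces `s_a = 0`). [this work] -/
theorem le_of_prod_le_of_add_le {sa sb dac dbc : ℝ} (hdac : 0 ≤ dac) (hdbc : 0 ≤ dbc)
    (hprod : sa * sb ≤ dac * dbc) (hlin : sa + dac ≤ sb + dbc) : sa ≤ dbc := by
  by_contra h
  push Not at h
  have hfac : (sa - dbc) * (sb + dbc) ≤ 0 := by nlinarith
  have hzero : sb + dbc ≤ 0 := by
    by_contra h'
    push Not at h'
    have : 0 < (sa - dbc) * (sb + dbc) := mul_pos (by linarith) h'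
    linarith
  nlinarith

/-- **V3MAX ⟹ Zmax.**  For distinct `o, a, b, c` with `q_a ≤ q_b`, `q_a ≤ q_c` and `max(q_b, q_c) ≥ ½`:
`μ(B = {a}) ≤ μ(B = {b,c})` (apply `CondTwoPoint` with the larger of `b, c` as the strongest vertex, then
`le_of_prod_le_of_add_le` with the linear relation `q_a ≤ q_·` written in atoms). [this work] -/
theorem zmax_of_condTwoPoint (hV : CondTwoPoint) (w : Sym2 (Fin n) → unitInterval) (o a b c : Fin n)
    (hoa : o ≠ a) (hob : o ≠ b) (hoc : o ≠ c) (hab : a ≠ b) (hac : a ≠ c) (hbc : b ≠ c)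
    (hqab : (prodBernoulli w).real (openConn o a) ≤ (prodBernoulli w).real (openConn o b))
    (hqac : (prodBernoulli w).real (openConn o a) ≤ (prodBernoulli w).real (openConn o c))
    (hhalf : 1 / 2 ≤ max ((prodBernoulli w).real (openConn o b)) ((prodBernoulli w).real (openConn o c))) :
    (prodBernoulli w).real {ω : BondConfig (Fin n) | ω ∈ openConn o a ∧ ω ∉ openConn o b ∧ ω ∉ openConn o c} ≤
      (prodBernoulli w).real {ω : BondConfig (Fin n) | ω ∉ openConn o a ∧ ω ∈ openConn o b ∧ ω ∈ openConn o c} := by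
  set μ := prodBernoulli w with hμ
  -- atoms
  set sa := μ.real {ω : BondConfig (Fin n) | ω ∈ openConn o a ∧ ω ∉ openConn o b ∧ ω ∉ openConn o c} with hsa
  set sb := μ.real {ω : BondConfig (Fin n) | ω ∉ openConn o a ∧ ω ∈ openConn o b ∧ ω ∉ openConn o c} with hsb
  set sc := μ.real {ω : BondConfig (Fin n) | ω ∉ openConn o a ∧ ω ∉ openConn o b ∧ ω ∈ openConn o c} with hsc
  set dab := μ.real {ω : BondConfig (Fin n) | ω ∈ openConn o a ∧ ω ∈ openConn o b ∧ ω ∉ openConn o c} with hdab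
  set dac := μ.real {ω : BondConfig (Fin n) | ω ∈ openConn o a ∧ ω ∉ openConn o b ∧ ω ∈ openConn o c} with hdac
  set dbc := μ.real {ω : BondConfig (Fin n) | ω ∉ openConn o a ∧ ω ∈ openConn o b ∧ ω ∈ openConn o c} with hdbc
  have h0sa : 0 ≤ sa := measureReal_nonneg
  have h0sb : 0 ≤ sb := measureReal_nonneg
  have h0sc : 0 ≤ sc := measureReal_nonneg
  have h0dab : 0 ≤ dab := measureReal_nonneg
  have h0dac : 0 ≤ dac := measureReal_nonneg
  have h0dbc : 0 ≤ dbc := measureReal_nonneg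
  -- the linear relations `q_a − q_b = (sa + dac) − (sb + dbc)` and `q_a − q_c = (sa + dab) − (sc + dbc)`
  have hlin_ab : sa + dac ≤ sb + dbc := by
    have h := real_openConn_sub μ o a b
    have h1 := real_conn_notConn_split μ o a b c
    have h2 := real_conn_notConn_split μ o b a c
    have e1 : {ω : BondConfig (Fin n) | ω ∈ openConn o b ∧ ω ∉ openConn o a ∧ ω ∉ openConn o c} =
        {ω : BondConfig (Fin n) | ω ∉ openConn o a ∧ ω ∈ openConn o b ∧ ω ∉ openConn o c} := by
      ext ω; simp only [mem_setOf_eq]; tauto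
    have e2 : {ω : BondConfig (Fin n) | ω ∈ openConn o b ∧ ω ∉ openConn o a ∧ ω ∈ openConn o c} =
        {ω : BondConfig (Fin n) | ω ∉ openConn o a ∧ ω ∈ openConn o b ∧ ω ∈ openConn o c} := by
      ext ω; simp only [mem_setOf_eq]; tauto
    rw [e1, e2] at h2
    linarith
  have hlin_ac : sa + dab ≤ sc + dbc := by
    have h := real_openConn_sub μ o a c
    have h1 := real_conn_notConn_split μ o a c b
    have h2 := real_conn_notConn_split μ o c a b
    have e0 : {ω : BondConfig (Fin n) | ω ∈ openConn o a ∧ ω ∉ openConn o c ∧ ω ∉ openConn o b} =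
        {ω : BondConfig (Fin n) | ω ∈ openConn o a ∧ ω ∉ openConn o b ∧ ω ∉ openConn o c} := by
      ext ω; simp only [mem_setOf_eq]; tauto
    have e0' : {ω : BondConfig (Fin n) | ω ∈ openConn o a ∧ ω ∉ openConn o c ∧ ω ∈ openConn o b} =
        {ω : BondConfig (Fin n) | ω ∈ openConn o a ∧ ω ∈ openConn o b ∧ ω ∉ openConn o c} := by
      ext ω; simp only [mem_setOf_eq]; tauto
    have e1 : {ω : BondConfig (Fin n) | ω ∈ openConn o c ∧ ω ∉ openConn o a ∧ ω ∉ openConn o b} =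
        {ω : BondConfig (Fin n) | ω ∉ openConn o a ∧ ω ∉ openConn o b ∧ ω ∈ openConn o c} := by
      ext ω; simp only [mem_setOf_eq]; tauto
    have e2 : {ω : BondConfig (Fin n) | ω ∈ openConn o c ∧ ω ∉ openConn o a ∧ ω ∈ openConn o b} =
        {ω : BondConfig (Fin n) | ω ∉ openConn o a ∧ ω ∈ openConn o b ∧ ω ∈ openConn o c} := by
      ext ω; simp only [mem_setOf_eq]; tauto
    rw [e0, e0'] at h1
    rw [e1, e2] at h2
    linarith
  rcases le_total (μ.real (openConn o b)) (μ.real (openConn o c)) with hle | hle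
  · -- `c` is the strongest
    have hc_half : 1 / 2 ≤ μ.real (openConn o c) := le_trans hhalf (max_le hle le_rfl)
    have hP := hV n w o a b c hoa hob hoc hab hac hbc hqac hle hc_half
    exact le_of_prod_le_of_add_le h0dac h0dbc hP hlin_ab
  · -- `b` is the strongest: apply V3MAX to `(a, c; b)`
    have hb_half : 1 / 2 ≤ μ.real (openConn o b) := le_trans hhalf (max_le le_rfl hle)
    have hP := hV n w o a c b hoa hoc hob hac hab hbc.symm hqab hle hb_half
    have e1 : {ω : BondConfig (Fin n) | ω ∈ openConn o a ∧ ω ∉ openConn o c ∧ ω ∉ openConn o b} =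
        {ω : BondConfig (Fin n) | ω ∈ openConn o a ∧ ω ∉ openConn o b ∧ ω ∉ openConn o c} := by
      ext ω; simp only [mem_setOf_eq]; tauto
    have e2 : {ω : BondConfig (Fin n) | ω ∉ openConn o a ∧ ω ∈ openConn o c ∧ ω ∉ openConn o b} =
        {ω : BondConfig (Fin n) | ω ∉ openConn o a ∧ ω ∉ openConn o b ∧ ω ∈ openConn o c} := by
      ext ω; simp only [mem_setOf_eq]; tauto
    have e3 : {ω : BondConfig (Fin n) | ω ∈ openConn o a ∧ ω ∉ openConn o c ∧ ω ∈ openConn o b} =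
        {ω : BondConfig (Fin n) | ω ∈ openConn o a ∧ ω ∈ openConn o b ∧ ω ∉ openConn o c} := by
      ext ω; simp only [mem_setOf_eq]; tauto
    have e4 : {ω : BondConfig (Fin n) | ω ∉ openConn o a ∧ ω ∈ openConn o c ∧ ω ∈ openConn o b} =
        {ω : BondConfig (Fin n) | ω ∉ openConn o a ∧ ω ∈ openConn o b ∧ ω ∈ openConn o c} := by
      ext ω; simp only [mem_setOf_eq]; tauto
    rw [e1, e2, e3, e4] at hP
    exact le_of_prod_le_of_add_le h0dab h0dbc hP hlin_ac

/-- **V3MAX ⟹ (POCKET-½)** (the hypothesis of `oneCut5_at_of_mem_of_pocketHalf`): `q_a ≥ ½`, `q_a ≤ q_b`, `q_a ≤ q_c` ⟹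
`μ(B = {a}) ≤ μ(B = {b,c})`. [this work] -/
theorem pocketHalf_of_condTwoPoint (hV : CondTwoPoint) :
    ∀ (n : ℕ) (w : Sym2 (Fin n) → unitInterval) (o a b c : Fin n),
      o ≠ a → o ≠ b → o ≠ c → a ≠ b → a ≠ c → b ≠ c →
      1 / 2 ≤ (prodBernoulli w).real (openConn o a) →
      (prodBernoulli w).real (openConn o a) ≤ (prodBernoulli w).real (openConn o b) →
      (prodBernoulli w).real (openConn o a) ≤ (prodBernoulli w).real (openConn o c) →
      (prodBernoulli w).real {ω : BondConfig (Fin n) | ω ∈ openConn o a ∧ ω ∉ openConn o b ∧ ω ∉ openConn o c} ≤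
        (prodBernoulli w).real {ω : BondConfig (Fin n) | ω ∉ openConn o a ∧ ω ∈ openConn o b ∧ ω ∈ openConn o c} := by
  intro n w o a b c hoa hob hoc hab hac hbc hhalf hqab hqac
  exact zmax_of_condTwoPoint hV w o a b c hoa hob hoc hab hac hbc hqab hqac (le_trans (le_trans hhalf hqab) (le_max_left _ _))

/-- **V3MAX ⟹ `Z(3,2)`** (`ZeroOneThree`): with `Σ q > 2` and `a` the weakest, `q_b + q_c > 2 − q_a ≥ 1`, so `max(q_b,q_c) ≥ ½`.
[this work] -/
theorem zeroOneThree_of_condTwoPoint (hV : CondTwoPoint) : ZeroOneThree := by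
  refine zeroOneThree_of_pocketExchange ?_
  intro n w o a b c hoa hob hoc hab hac hbc hsum hqab hqac
  have ha1 : (prodBernoulli w).real (openConn o a) ≤ 1 := measureReal_le_one
  have hmax : 1 / 2 ≤ max ((prodBernoulli w).real (openConn o b)) ((prodBernoulli w).real (openConn o c)) := by
    by_contra h
    push Not at h
    have hb := lt_of_le_of_lt (le_max_left _ _) h
    have hc := lt_of_le_of_lt (le_max_right _ _) h
    linarith
  exact zmax_of_condTwoPoint hV w o a b c hoa hob hoc hab hac hbc hqab hqac hmax

/-- **V3MAX ⟹ the glued half of oneCut(5).**  If `o ∈ A`, `A.card = 5` and all relay–relay cuts are `≤ t`, then the minority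
event `{1 ≤ N < E N/2}` has mass `≤ t` (via (POCKET-½), `oneCut5_at_of_mem_of_pocketHalf`). [this work] -/
theorem oneCut5_at_of_mem_of_condTwoPoint (hV : CondTwoPoint) (w : Sym2 (Fin n) → unitInterval) (A : Finset (Fin n))
    (o : Fin n) (t : ℝ) (hA : A.card = 5) (ho : o ∈ A) (ht : 0 ≤ t)
    (hcut : ∀ a ∈ A, ∀ a' ∈ A, a ≠ a' → (prodBernoulli w).real (openConn a a')ᶜ ≤ t) :
    (prodBernoulli w).real {ω : BondConfig (Fin n) |
        1 ≤ (A.filter fun a => ω ∈ openConn o a).card ∧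
        ((A.filter fun a => ω ∈ openConn o a).card : ℝ) <
          (∑ a ∈ A, (prodBernoulli w).real (openConn o a)) / 2} ≤ t :=
  oneCut5_at_of_mem_of_pocketHalf (pocketHalf_of_condTwoPoint hV) w A o t hA ho ht hcut

/-- **V3MAX ⟹ the two-finger bound at a relay observer** (`E N > 4`, cuts `μ(o ↮ b) ≤ t`). [this work] -/
theorem twoFinger_at_observer_of_condTwoPoint (hV : CondTwoPoint) (w : Sym2 (Fin n) → unitInterval)
    (A : Finset (Fin n)) (o : Fin n) (t : ℝ) (hA : A.card = 5) (ho : o ∈ A)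
    (hEN : 4 < ∑ x ∈ A, (prodBernoulli w).real (openConn o x))
    (hcut : ∀ b ∈ A, b ≠ o → (prodBernoulli w).real (openConn o b)ᶜ ≤ t) :
    (prodBernoulli w).real {ω : BondConfig (Fin n) | (A.filter fun x => ω ∈ openConn o x).card ≤ 2} ≤ t :=
  twoFinger_at_observer_of_pocketHalf (pocketHalf_of_condTwoPoint hV) w A o t hA ho hEN hcut

end OneCutFive

end Summit.CriticalPhenomena.PercolationContinuityZ3.Theorems

end
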